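import Mathlib
import Literature.Analysis.Complex.QuarterStripContinuation
import Literature.Analysis.Complex.StripTilingEntire

/-!
# HRP2 rigidity, line `xray-mellin-transfer`, stub S2: strip tiling

Registered stub `stub_stripTilingEntire` of crux `stmt-CriticalPhenomena-1979`
(`Summit.CriticalPhenomena.Ising3DConformalLimit.Theses.HyperoctahedralRP.HRP2Rigidity`),
line `xray-mellin-transfer`.

**Statement.** A continuous `π`-periodic real profile `κ`, symmetric about the points
`γ₁ + π/2` and `γ₂ + π/2` with `γ₂ - γ₁ ∉ (π/2)ℤ`, whose two traces
`κ(γⱼ + π/2 - θ) = (cos θ)^{-β} Fⱼ(tan θ)` (`0 < θ < π/2`) come from functions `Fⱼ` holomorphic on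
the right half-plane with `‖Fⱼ t‖ ≤ C (Re t)^{-β}` (`β ≥ 0`), is the restriction to `ℝ` of an entire
function `G` of exponential type `≤ β`: `‖G ω‖ ≤ C' e^{β |Im ω|}`.

**Proof.** Assembled from three Literature theorems (topic `Literature/Analysis/Complex`):
1. `Literature.Analysis.Complex.exists_quarterStrip_continuation`: `Φⱼ(θ) = (cos θ)^{-β} Fⱼ(tan θ)`
   (principal branch) is holomorphic on the quarter strip `0 < Re θ < π/2` (`Re cos > 0`,
   `Re tan > 0` there), restricts to the real formula, hence to `κ(γⱼ + π/2 - θ)`, and obeys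
   `‖Φⱼ(a+ib)‖ ≤ C (e^{|b|} / (sin a cos a))^β`. (`C ≥ 0` because the half-plane is nonempty.)
2. `Literature.Analysis.Complex.exists_tiled_continuation`: the period `π` and the reflection
   `ω ↦ 2γⱼ + π - ω` of `κ` transport `Φⱼ` to every open strip between consecutive lines
   `Re ω ∈ γⱼ + (π/2)ℤ`, giving `Aⱼ` holomorphic off those lines, equal to `κ` at real points off
   the lines, with the transported growth bound.
3. `Literature.Analysis.Complex.exists_entire_of_two_tilings`: since `γ₂ - γ₁ ∉ (π/2)ℤ` the two
   line families are disjoint; `A₁ = A₂` on common strips by the identity theorem from the real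
   values; the glued function is entire, restricts to `κ`, and every abscissa is uniformly far from
   one of the two families, whence `‖G ω‖ ≤ C' e^{β |Im ω|}`.

References: R. P. Boas, *Entire Functions* (1954), Ch. 1–2 (exponential type); identity theorem =
Mathlib `AnalyticOnNhd.eqOn_of_preconnected_of_frequently_eq`.
-/

noncomputable section

open scoped Real

namespace Summit.CriticalPhenomena.Ising3DConformalLimit.Cruxes.HRP2Rigidity.XRayMellin

open Literature.Analysis.Complex in
/-- Registered stub `stub_stripTilingEntire` — **S2 · strip tiling.** A continuous `π`-periodic
profile `κ`, symmetric about `γ₁ + π/2` and `γ₂ + π/2` with `γ₂ - γ₁ ∉ (π/2)ℤ`, whose two traces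
`κ(γⱼ + π/2 - θ) = (cos θ)^{-β} Fⱼ(tan θ)` (`0 < θ < π/2`) come from functions `Fⱼ` holomorphic on
the right half-plane with `‖Fⱼ(t)‖ ≤ C (Re t)^{-β}`, is the restriction of an entire function `G` of
exponential type `≤ β`: `‖G ω‖ ≤ C' e^{β |Im ω|}`. Proof: quarter-strip continuation, strip
tiling along each reflection family, gluing of the two tilings (see the module docstring). -/
theorem stub_stripTilingEntire :
    ∀ (κ : ℝ → ℝ) (β γ₁ γ₂ C : ℝ) (F₁ F₂ : ℂ → ℂ), 0 ≤ β →
      Continuous κ → (∀ ω, κ (ω + Real.pi) = κ ω) →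
      (∀ ω, κ (2 * γ₁ + Real.pi - ω) = κ ω) → (∀ ω, κ (2 * γ₂ + Real.pi - ω) = κ ω) →
      (∀ k : ℤ, γ₂ - γ₁ ≠ (k : ℝ) * (Real.pi / 2)) →
      DifferentiableOn ℂ F₁ {t : ℂ | 0 < t.re} → DifferentiableOn ℂ F₂ {t : ℂ | 0 < t.re} →
      (∀ t : ℂ, 0 < t.re → ‖F₁ t‖ ≤ C * t.re ^ (-β)) → (∀ t : ℂ, 0 < t.re → ‖F₂ t‖ ≤ C * t.re ^ (-β)) →
      (∀ θ : ℝ, 0 < θ → θ < Real.pi / 2 →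
        ((κ (γ₁ + Real.pi / 2 - θ) : ℝ) : ℂ) = ((Real.cos θ ^ (-β) : ℝ) : ℂ) * F₁ ((Real.tan θ : ℝ) : ℂ)) →
      (∀ θ : ℝ, 0 < θ → θ < Real.pi / 2 →
        ((κ (γ₂ + Real.pi / 2 - θ) : ℝ) : ℂ) = ((Real.cos θ ^ (-β) : ℝ) : ℂ) * F₂ ((Real.tan θ : ℝ) : ℂ)) →
      ∃ G : ℂ → ℂ, Differentiable ℂ G ∧ (∀ ω : ℝ, G ω = ((κ ω : ℝ) : ℂ)) ∧
        ∃ C' : ℝ, ∀ ω : ℂ, ‖G ω‖ ≤ C' * Real.exp (β * |ω.im|) := by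
  intro κ β γ₁ γ₂ C F₁ F₂ hβ _hκc hper hrefl₁ hrefl₂ hγ hF₁d hF₂d hF₁b hF₂b hκ₁ hκ₂
  -- `C ≥ 0`: the right half-plane is nonempty
  have hC : 0 ≤ C := by
    have h := hF₁b 1 (by simp)
    simp only [Complex.one_re, Real.one_rpow, mul_one] at h
    exact (norm_nonneg _).trans h
  -- Step 1: the quarter-strip continuations `Φⱼ(θ) = (cos θ)^{-β} Fⱼ(tan θ)`
  obtain ⟨Φ₁, hΦ₁d, hΦ₁r, hΦ₁g⟩ := exists_quarterStrip_continuation hβ hF₁d hF₁b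
  obtain ⟨Φ₂, hΦ₂d, hΦ₂r, hΦ₂g⟩ := exists_quarterStrip_continuation hβ hF₂d hF₂b
  have hΦ₁κ : ∀ θ : ℝ, 0 < θ → θ < π / 2 → Φ₁ θ = κ (γ₁ + π / 2 - θ) := fun θ h1 h2 => by
    rw [hΦ₁r θ h1 h2, hκ₁ θ h1 h2]
  have hΦ₂κ : ∀ θ : ℝ, 0 < θ → θ < π / 2 → Φ₂ θ = κ (γ₂ + π / 2 - θ) := fun θ h1 h2 => by
    rw [hΦ₂r θ h1 h2, hκ₂ θ h1 h2]
  -- Step 2: tile each reflection family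
  obtain ⟨A₁, hd₁, hr₁, hb₁⟩ := exists_tiled_continuation hβ hC hper hrefl₁ hΦ₁d hΦ₁κ hΦ₁g
  obtain ⟨A₂, hd₂, hr₂, hb₂⟩ := exists_tiled_continuation hβ hC hper hrefl₂ hΦ₂d hΦ₂κ hΦ₂g
  -- Step 3: glue the two tilings
  exact exists_entire_of_two_tilings hβ hC hγ hd₁ hr₁ hb₁ hd₂ hr₂ hb₂

end Summit.CriticalPhenomena.Ising3DConformalLimit.Cruxes.HRP2Rigidity.XRayMellin
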